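import Literature.Analysis.Approximation.CarberyWrightProofs
import Mathlib.Analysis.Calculus.Taylor
import Mathlib.Analysis.Calculus.IteratedDeriv.Defs
import Mathlib.Analysis.SpecialFunctions.Pow.Real
import Mathlib.Analysis.SpecialFunctions.Log.Basic
import Mathlib.Analysis.Complex.ExponentialBounds
import Mathlib.Algebra.Polynomial.BigOperators
import HarnessLib

/-!
# Propagation of smallness for functions with factorial derivative bounds — the one-dimensional step

Towards a proof of the named fact `Literature.Analysis.PDE.analyticPropagationOfSmallness`
(Apraiz–Escauriaza–Wang–Zhang 2014, Thm 4 / Vessella 1999).  This file: a function `g : ℝ → ℝ` of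
class `C^∞` with `|g⁽ᵏ⁾| ≤ M k! r⁻ᵏ` on a SHORT interval `[a, b]` (`b - a ≤ σ r/(32e)`) which is
`≤ B` on a subset of measure `≥ σ (b - a)` satisfies `|g| ≤ 8 B^θ M^{1-θ}` on `[a, b]`,
`θ = log 2 / log (16e/σ)`.  Proof: Taylor polynomial of degree `d` (Mathlib's
`taylor_mean_remainder_bound`) + the weak Remez inequality for polynomials on measurable sets
(`CarberyWright.remez_weak`, Lagrange interpolation) + optimisation in `d`.  Theorems only.
-/

noncomputable section

open Set MeasureTheory Real Polynomial

namespace Literature.Analysis.PDE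

namespace AnalyticSmallness

/-- **Taylor polynomial with remainder, as a genuine polynomial.**  For `g` smooth with
`|g⁽ᵏ⁾| ≤ M k!/rᵏ` on `[a,b]` and every degree `d` there is `P ∈ ℝ[X]`, `deg P ≤ d`, with
`|g - P| ≤ M (d+1) ((b-a)/r)^{d+1}` on `[a,b]` (Taylor expansion at `a`, Lagrange remainder). [folklore] -/
private theorem exists_taylorPoly {g : ℝ → ℝ} (hg : ContDiff ℝ (⊤ : ℕ∞) g) {a b M r : ℝ} (hab : a < b)
    (hr : 0 < r)
    (hD : ∀ (k : ℕ), ∀ t ∈ Icc a b, |iteratedDeriv k g t| ≤ M * (k.factorial : ℝ) / r ^ k)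
    (d : ℕ) :
    ∃ P : ℝ[X], P.natDegree ≤ d ∧
      ∀ t ∈ Icc a b, |g t - P.eval t| ≤ M * (d + 1) * ((b - a) / r) ^ (d + 1) := by
  have hU : UniqueDiffOn ℝ (Icc a b) := uniqueDiffOn_Icc hab
  have hwithin : ∀ (k : ℕ), ∀ t ∈ Icc a b,
      iteratedDerivWithin k g (Icc a b) t = iteratedDeriv k g t := fun k t ht =>
    iteratedDerivWithin_eq_iteratedDeriv hU (hg.of_le (mod_cast le_top)).contDiffAt ht
  have hM : 0 ≤ M := by
    have h := hD 0 a (left_mem_Icc.2 hab.le)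
    simp only [iteratedDeriv_zero, Nat.factorial_zero, Nat.cast_one, mul_one, pow_zero,
      div_one] at h
    exact (abs_nonneg _).trans h
  refine ⟨∑ k ∈ Finset.range (d + 1),
      C (((k.factorial : ℝ))⁻¹ * iteratedDeriv k g a) * (X - C a) ^ k, ?_, ?_⟩
  · refine natDegree_sum_le_of_forall_le _ _ fun k hk => ?_
    have hk' : k ≤ d := Nat.lt_succ_iff.1 (Finset.mem_range.1 hk)
    calc (C (((k.factorial : ℝ))⁻¹ * iteratedDeriv k g a) * (X - C a) ^ k).natDegree
        ≤ ((X - C a) ^ k).natDegree := natDegree_C_mul_le _ _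
      _ ≤ k * (X - C a).natDegree := natDegree_pow_le
      _ = k := by rw [natDegree_X_sub_C, mul_one]
      _ ≤ d := hk'
  · intro t ht
    have hgd : ContDiffOn ℝ (d + 1) g (Icc a b) := (hg.of_le (mod_cast le_top)).contDiffOn
    have hC : ∀ y ∈ Icc a b, ‖iteratedDerivWithin (d + 1) g (Icc a b) y‖ ≤
        M * ((d + 1).factorial : ℝ) / r ^ (d + 1) := by
      intro y hy
      rw [hwithin _ y hy, Real.norm_eq_abs]
      exact hD (d + 1) y hy
    have hrem := taylor_mean_remainder_bound hab.le hgd ht hC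
    have hpoly : taylorWithinEval g d (Icc a b) a t =
        (∑ k ∈ Finset.range (d + 1),
          C (((k.factorial : ℝ))⁻¹ * iteratedDeriv k g a) * (X - C a) ^ k).eval t := by
      rw [taylor_within_apply, eval_finsetSum]
      refine Finset.sum_congr rfl fun k _ => ?_
      rw [hwithin k a (left_mem_Icc.2 hab.le), eval_mul, eval_C, eval_pow, eval_sub, eval_X,
        eval_C, smul_eq_mul]
      ring
    have hta : 0 ≤ t - a := sub_nonneg.2 ht.1
    have htb : t - a ≤ b - a := sub_le_sub_right ht.2 a
    have hdfac : (0 : ℝ) < (d.factorial : ℝ) := by positivity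
    rw [← hpoly]
    calc |g t - taylorWithinEval g d (Icc a b) a t|
        = ‖g t - taylorWithinEval g d (Icc a b) a t‖ := (Real.norm_eq_abs _).symm
      _ ≤ M * ((d + 1).factorial : ℝ) / r ^ (d + 1) * (t - a) ^ (d + 1) / (d.factorial : ℝ) :=
          hrem
      _ ≤ M * ((d + 1).factorial : ℝ) / r ^ (d + 1) * (b - a) ^ (d + 1) / (d.factorial : ℝ) := by
          gcongr
      _ = M * (d + 1) * ((b - a) / r) ^ (d + 1) := by
          rw [Nat.factorial_succ, Nat.cast_mul, div_pow]
          push_cast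
          field_simp

/-- **One Remez–Taylor step, every degree.**  If moreover `S ⊆ [a,b]` has (outer) measure
`≥ σ (b-a)` and `|g| ≤ B` on `S`, then for every `d`,
`|g| ≤ e (8e/σ)^d (B + ε_d) + ε_d` on `[a,b]`, `ε_d = M (d+1) ((b-a)/r)^{d+1}`
(the weak Remez inequality `CarberyWright.remez_weak` applied to the Taylor polynomial). [folklore] -/
private theorem abs_le_of_degree {g : ℝ → ℝ} (hg : ContDiff ℝ (⊤ : ℕ∞) g) {a b M r : ℝ} (hab : a < b)
    (hr : 0 < r)
    (hD : ∀ (k : ℕ), ∀ t ∈ Icc a b, |iteratedDeriv k g t| ≤ M * (k.factorial : ℝ) / r ^ k)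
    {S : Set ℝ} (hS : S ⊆ Icc a b) {σ : ℝ} (hσ : 0 < σ)
    (hSvol : ENNReal.ofReal (σ * (b - a)) ≤ volume S) {B : ℝ} (hB : ∀ y ∈ S, |g y| ≤ B)
    (d : ℕ) {t : ℝ} (ht : t ∈ Icc a b) :
    |g t| ≤ Real.exp 1 * (8 * Real.exp 1 / σ) ^ d * (B + M * (d + 1) * ((b - a) / r) ^ (d + 1))
      + M * (d + 1) * ((b - a) / r) ^ (d + 1) := by
  obtain ⟨P, hPd, hP⟩ := exists_taylorPoly hg hab hr hD d
  set ε := M * (d + 1) * ((b - a) / r) ^ (d + 1) with hε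
  have hPB : ∀ y ∈ S, |P.eval y| ≤ B + ε := fun y hy => by
    have h1 := hP y (hS hy)
    have h2 := hB y hy
    calc |P.eval y| = |g y - (g y - P.eval y)| := by rw [sub_sub_cancel]
      _ ≤ |g y| + |g y - P.eval y| := abs_sub _ _
      _ ≤ B + ε := add_le_add h2 h1
  have hba : 0 < b - a := sub_pos.2 hab
  have hs : 0 < σ * (b - a) := mul_pos hσ hba
  have hrem := Literature.Analysis.Approximation.CarberyWright.remez_weak hPd hs hS hSvol hPB ht
  have hK : 8 * Real.exp 1 * (b - a) / (σ * (b - a)) = 8 * Real.exp 1 / σ := by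
    field_simp
  rw [hK] at hrem
  calc |g t| = |P.eval t + (g t - P.eval t)| := by rw [add_sub_cancel]
    _ ≤ |P.eval t| + |g t - P.eval t| := abs_add_le _ _
    _ ≤ _ := add_le_add hrem (hP t ht)

/-- **The short-interval bound, cleaned up**: if in addition `b - a ≤ σ r/(32 e)`, `σ ≤ 1` and
`B ≥ 0`, then for every degree `d`, `|g| ≤ e (8e/σ)^d B + M 2^{-d}` on `[a,b]`. [folklore] -/
private theorem abs_le_geom {g : ℝ → ℝ} (hg : ContDiff ℝ (⊤ : ℕ∞) g) {a b M r : ℝ} (hab : a < b)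
    (hr : 0 < r) (hM : 0 ≤ M)
    (hD : ∀ (k : ℕ), ∀ t ∈ Icc a b, |iteratedDeriv k g t| ≤ M * (k.factorial : ℝ) / r ^ k)
    {S : Set ℝ} (hS : S ⊆ Icc a b) {σ : ℝ} (hσ : 0 < σ) (hσ1 : σ ≤ 1)
    (hSvol : ENNReal.ofReal (σ * (b - a)) ≤ volume S) {B : ℝ}
    (hB : ∀ y ∈ S, |g y| ≤ B) (hshort : b - a ≤ σ / (32 * Real.exp 1) * r)
    (d : ℕ) {t : ℝ} (ht : t ∈ Icc a b) :
    |g t| ≤ Real.exp 1 * (8 * Real.exp 1 / σ) ^ d * B + M * (1 / 2) ^ d := by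
  have h := abs_le_of_degree hg hab hr hD hS hσ hSvol hB d ht
  set K := 8 * Real.exp 1 / σ with hK
  set q := (b - a) / r with hq
  set q₀ := σ / (32 * Real.exp 1) with hq₀
  have he1 : 1 ≤ Real.exp 1 := Real.one_le_exp (by norm_num)
  have hepos : 0 < Real.exp 1 := Real.exp_pos 1
  have hq0 : 0 ≤ q := div_nonneg (sub_pos.2 hab).le hr.le
  have hqq₀ : q ≤ q₀ := by
    rw [hq, div_le_iff₀ hr]
    exact hshort
  have hq₀0 : 0 ≤ q₀ := by positivity
  have hKpos : 0 < K := by positivity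
  have hK1 : 1 ≤ K := by
    rw [hK, le_div_iff₀ hσ]
    nlinarith
  have hKq₀ : K * q₀ = 1 / 4 := by
    rw [hK, hq₀]
    field_simp
    ring
  have h2eq₀ : 2 * Real.exp 1 * q₀ ≤ 1 := by
    rw [hq₀]
    field_simp
    nlinarith
  set ε := M * (d + 1) * q ^ (d + 1) with hε
  have hε0 : 0 ≤ ε := by positivity
  have hKd : 1 ≤ Real.exp 1 * K ^ d := one_le_mul_of_one_le_of_one_le he1 (one_le_pow₀ hK1)
  -- `(d+1) (1/4)^d ≤ (1/2)^d`
  have hd2 : ((d : ℝ) + 1) * (1 / 4 : ℝ) ^ d ≤ (1 / 2) ^ d := by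
    have h1 : ((d : ℝ) + 1) ≤ 2 ^ d := by exact_mod_cast Nat.lt_two_pow_self
    have h2 : (1 / 4 : ℝ) ^ d = (1 / 2) ^ d * (1 / 2) ^ d := by rw [← mul_pow]; norm_num
    rw [h2]
    calc ((d : ℝ) + 1) * ((1 / 2) ^ d * (1 / 2) ^ d) = (((d : ℝ) + 1) * (1 / 2) ^ d) * (1 / 2) ^ d := by
          ring
      _ ≤ 1 * (1 / 2) ^ d := by
          gcongr
          rw [show ((1:ℝ) / 2) ^ d = 1 / 2 ^ d by rw [div_pow, one_pow]]
          rw [mul_div_assoc', div_le_one (by positivity), mul_comm, one_mul]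
          exact h1
      _ = (1 / 2) ^ d := one_mul _
  have step1 : |g t| ≤ Real.exp 1 * K ^ d * B + 2 * (Real.exp 1 * K ^ d) * ε := by
    have : (Real.exp 1 * K ^ d + 1) * ε ≤ 2 * (Real.exp 1 * K ^ d) * ε := by
      apply mul_le_mul_of_nonneg_right _ hε0
      linarith
    calc |g t| ≤ Real.exp 1 * K ^ d * (B + ε) + ε := h
      _ = Real.exp 1 * K ^ d * B + (Real.exp 1 * K ^ d + 1) * ε := by ring
      _ ≤ Real.exp 1 * K ^ d * B + 2 * (Real.exp 1 * K ^ d) * ε := by linarith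
  have step2 : 2 * (Real.exp 1 * K ^ d) * ε ≤ M * (1 / 2) ^ d := by
    calc 2 * (Real.exp 1 * K ^ d) * ε
        = 2 * Real.exp 1 * M * ((d : ℝ) + 1) * (K ^ d * q ^ (d + 1)) := by rw [hε]; ring
      _ ≤ 2 * Real.exp 1 * M * ((d : ℝ) + 1) * (K ^ d * q₀ ^ (d + 1)) := by
          gcongr
      _ = (2 * Real.exp 1 * q₀) * (M * (((d : ℝ) + 1) * (K * q₀) ^ d)) := by rw [mul_pow]; ring
      _ ≤ 1 * (M * (((d : ℝ) + 1) * (K * q₀) ^ d)) := by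
          apply mul_le_mul_of_nonneg_right h2eq₀
          positivity
      _ = M * (((d : ℝ) + 1) * (1 / 4) ^ d) := by rw [hKq₀, one_mul]
      _ ≤ M * (1 / 2) ^ d := mul_le_mul_of_nonneg_left hd2 hM
  linarith


/-- **Short-interval propagation of smallness (Hölder form).**  For `g` smooth with
`|g⁽ᵏ⁾| ≤ M k!/rᵏ` on `[a,b]`, `M > 0`, `b - a ≤ σ r/(32e)`, `0 < σ ≤ 1`, and `|g| ≤ B` (`B ≥ 0`) on a
subset of `[a,b]` of measure `≥ σ (b-a)`: `|g| ≤ 8 B^θ M^{1-θ}` on `[a,b]` with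
`θ = log 2 / log (16e/σ)` (choose the degree `d ≈ log(M/B)/log(16e/σ)` in `abs_le_geom`).  This is the
one-dimensional, short-interval case of the propagation-of-smallness inequality for real-analytic
functions (Vessella 1999; Apraiz–Escauriaza–Wang–Zhang 2014, Thm 4), with non-optimised constants.
[cite: ApraizEscauriazaWangZhang2014, Theorem 4 (case n = 1, short interval)] -/
theorem abs_le_rpow_short {g : ℝ → ℝ} (hg : ContDiff ℝ (⊤ : ℕ∞) g) {a b M r : ℝ} (hab : a < b)
    (hr : 0 < r) (hM : 0 < M)
    (hD : ∀ (k : ℕ), ∀ t ∈ Icc a b, |iteratedDeriv k g t| ≤ M * (k.factorial : ℝ) / r ^ k)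
    {S : Set ℝ} (hS : S ⊆ Icc a b) {σ : ℝ} (hσ : 0 < σ) (hσ1 : σ ≤ 1)
    (hSvol : ENNReal.ofReal (σ * (b - a)) ≤ volume S) {B : ℝ} (hB0 : 0 ≤ B)
    (hB : ∀ y ∈ S, |g y| ≤ B) (hshort : b - a ≤ σ / (32 * Real.exp 1) * r)
    {t : ℝ} (ht : t ∈ Icc a b) :
    |g t| ≤ 8 * B ^ (Real.log 2 / Real.log (16 * Real.exp 1 / σ)) *
      M ^ (1 - Real.log 2 / Real.log (16 * Real.exp 1 / σ)) := by
  set K := 8 * Real.exp 1 / σ with hK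
  have h2K : 16 * Real.exp 1 / σ = 2 * K := by rw [hK]; ring
  rw [h2K]
  set θ := Real.log 2 / Real.log (2 * K) with hθ
  have he1 : 1 ≤ Real.exp 1 := Real.one_le_exp (by norm_num)
  have hKpos : 0 < K := by positivity
  have hK1 : 1 ≤ K := by
    rw [hK, le_div_iff₀ hσ]
    nlinarith
  have h2K1 : 1 < 2 * K := by linarith
  have h2K2 : 2 ≤ 2 * K := by linarith
  have hlog2 : 0 < Real.log 2 := Real.log_pos (by norm_num)
  have hlogK : 0 < Real.log (2 * K) := Real.log_pos h2K1
  have hlog2K : Real.log 2 ≤ Real.log (2 * K) := Real.log_le_log (by norm_num) h2K2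
  have hθpos : 0 < θ := div_pos hlog2 hlogK
  have hθ1 : θ ≤ 1 := (div_le_one hlogK).2 hlog2K
  -- the trivial bound `|g t| ≤ M`
  have hgM : |g t| ≤ M := by
    have h := hD 0 t ht
    simpa using h
  have hpow0 : 0 ≤ B ^ θ * M ^ (1 - θ) := by positivity
  by_cases hBM : M ≤ B
  · -- then `M ≤ B^θ M^{1-θ}`
    have h1 : M ≤ B ^ θ * M ^ (1 - θ) := by
      calc M = M ^ θ * M ^ (1 - θ) := by
            rw [← Real.rpow_add hM, add_sub_cancel, Real.rpow_one]
        _ ≤ B ^ θ * M ^ (1 - θ) := by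
            gcongr
    linarith
  push Not at hBM
  rcases hB0.eq_or_lt with hB00 | hBpos
  · -- `B = 0`: `|g t| ≤ M 2^{-d}` for every `d`, hence `g t = 0`
    rw [← hB00, Real.zero_rpow hθpos.ne', mul_zero, zero_mul]
    by_contra hne
    have hpos : 0 < |g t| := lt_of_not_ge hne
    obtain ⟨d, hd⟩ := exists_pow_lt_of_lt_one (div_pos hpos hM) (by norm_num : (1 / 2 : ℝ) < 1)
    have h := abs_le_geom hg hab hr hM.le hD hS hσ hσ1 hSvol hB hshort d ht
    rw [← hB00, mul_zero, zero_add] at h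
    have : M * (1 / 2 : ℝ) ^ d < |g t| := by
      calc M * (1 / 2 : ℝ) ^ d < M * (|g t| / M) := mul_lt_mul_of_pos_left hd hM
        _ = |g t| := by field_simp
    linarith
  · -- `0 < B < M`: choose the degree
    set x := M / B with hx
    have hx1 : 1 < x := (one_lt_div hBpos).2 hBM
    have hxpos : 0 < x := by positivity
    have hlogx : 0 < Real.log x := Real.log_pos hx1
    have hratio : 0 ≤ Real.log x / Real.log (2 * K) := div_nonneg hlogx.le hlogK.le
    set d := ⌊Real.log x / Real.log (2 * K)⌋₊ with hd
    have hd1 : (d : ℝ) ≤ Real.log x / Real.log (2 * K) := Nat.floor_le hratio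
    have hd2 : Real.log x / Real.log (2 * K) < d + 1 := Nat.lt_floor_add_one _
    -- (i) `(2K)^d ≤ x`, i.e. `K^d B ≤ M (1/2)^d`
    have hi : (2 * K) ^ d ≤ x := by
      have h1 : (d : ℝ) * Real.log (2 * K) ≤ Real.log x := (le_div_iff₀ hlogK).1 hd1
      calc (2 * K) ^ d = Real.exp (Real.log (2 * K) * d) := by
            rw [← Real.rpow_natCast, Real.rpow_def_of_pos (by positivity)]
        _ ≤ Real.exp (Real.log x) := Real.exp_le_exp.2 (by rw [mul_comm]; exact h1)
        _ = x := Real.exp_log hxpos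
    have hi' : K ^ d * B ≤ M * (1 / 2) ^ d := by
      have h1 : (2 * K) ^ d * B ≤ x * B := mul_le_mul_of_nonneg_right hi hB0
      rw [hx, div_mul_cancel₀ _ hBpos.ne', mul_pow] at h1
      have h2 : (2 : ℝ) ^ d * (1 / 2) ^ d = 1 := by rw [← mul_pow]; norm_num
      calc K ^ d * B = ((2 : ℝ) ^ d * (1 / 2) ^ d) * (K ^ d * B) := by rw [h2, one_mul]
        _ = (2 ^ d * K ^ d * B) * (1 / 2) ^ d := by ring
        _ ≤ M * (1 / 2) ^ d := mul_le_mul_of_nonneg_right h1 (by positivity)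
    -- (ii) `(1/2)^(d+1) < (B/M)^θ`
    have hii : (1 / 2 : ℝ) ^ (d + 1) < (B / M) ^ θ := by
      have hBM' : 0 < B / M := div_pos hBpos hM
      have h1 : (1 / 2 : ℝ) ^ (d + 1) = Real.exp (-(((d : ℝ) + 1) * Real.log 2)) := by
        rw [← Real.rpow_natCast, Real.rpow_def_of_pos (by norm_num : (0:ℝ) < 1 / 2)]
        congr 1
        rw [one_div, Real.log_inv]
        push_cast
        ring
      have h2 : (B / M) ^ θ = Real.exp (-(θ * Real.log x)) := by
        rw [Real.rpow_def_of_pos hBM', hx, Real.log_div hM.ne' hBpos.ne',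
          Real.log_div hBpos.ne' hM.ne']
        congr 1
        ring
      rw [h1, h2, Real.exp_lt_exp, neg_lt_neg_iff]
      have h3 : θ * Real.log x = Real.log 2 * (Real.log x / Real.log (2 * K)) := by
        rw [hθ]
        field_simp
      rw [h3]
      have := mul_lt_mul_of_pos_left hd2 hlog2
      linarith
    -- assemble
    have h := abs_le_geom hg hab hr hM.le hD hS hσ hσ1 hSvol hB hshort d ht
    have he3 : Real.exp 1 ≤ 3 := by
      have := Real.exp_one_lt_d9
      linarith
    have hBMθ : (B / M) ^ θ * M = B ^ θ * M ^ (1 - θ) := by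
      rw [Real.div_rpow hB0 hM.le, Real.rpow_sub hM, Real.rpow_one]
      field_simp
    calc |g t| ≤ Real.exp 1 * K ^ d * B + M * (1 / 2) ^ d := h
      _ = Real.exp 1 * (K ^ d * B) + M * (1 / 2) ^ d := by ring
      _ ≤ Real.exp 1 * (M * (1 / 2) ^ d) + M * (1 / 2) ^ d := by gcongr
      _ = (2 * (Real.exp 1 + 1)) * ((1 / 2) ^ (d + 1) * M) := by ring
      _ ≤ 8 * ((1 / 2) ^ (d + 1) * M) := by
          apply mul_le_mul_of_nonneg_right _ (by positivity)
          linarith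
      _ ≤ 8 * ((B / M) ^ θ * M) := by
          apply mul_le_mul_of_nonneg_left _ (by norm_num)
          exact mul_le_mul_of_nonneg_right hii.le hM.le
      _ = 8 * B ^ θ * M ^ (1 - θ) := by rw [hBMθ]; ring

end AnalyticSmallness

end Literature.Analysis.PDE

end
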